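import Summits.QuantumFields.YangMills.Theorems.FluctuationComparisonRegPrIntLS2BetaCorrLetterL2Relative
import Summits.QuantumFields.YangMills.Theorems.FluctuationComparisonRegPrIntLS2BetaLiftLadderRowsDock
import Literature.MathematicalPhysics.QuantumFieldTheory.Balaban1983to89.BlockAveragingPlaquetteBoundLocal
import Literature.MathematicalPhysics.QuantumFieldTheory.Balaban1983to89.B12GaugeOrbits021
import Summits.QuantumFields.YangMills.Theorems.FluctuationComparisonRegPrIntLS2BetaRelativeGaugeCovariance
import HarnessLib

/-!
# S2β · W-ρκ — THE κ-RATIO LETTER AT THE TOWER: `discRow'`'s hypothesis `hκrel` (px20 g24, `…LiftLadderDiscRowTower`) DISCHARGED from region letters in the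
# stage pair's fine-relative-plaquette ∕ relative-bond currency, over the TREE's relative Stokes (px21 g23 ✓`…RelativeWordStokes` A2 + ✓`…CorrLetterL2Relative` B):
# `ρκ t B := 3·(K·(ρP t B + 2·a′ t·((ℓ + 2)·δC t B)))`, `K = ℓ²∕4`, `ℓ = 5L`

Cell `ym3-torus` (rung R3 = continuum `SU(2)` YM₃ on T³ at fixed lattice data — NOT d = 4, NOT infinite volume, NOT a mass gap, NOT Clay).  Width seat
`ym3-torus-px16` (gen 24); crux `stmt-QuantumFields-20520` `FluctuationComparisonRegPrIntL`, LINE g18-1 S2β (registry `Lines/semiclassical_s2beta.lean` 3732b7df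
UNTOUCHED); organ GAP♯∘ ⟸ {h3, (D-stage)×2, LOC} ⟸ (ST) ⟸ LIFT-LADDER rows (✓`…LiftLadderRowsDock`) + the D′-budget split (✓`…LiftLadderDiscBudgetSplit`), whose
`hDisc` is px20 g24's tower row `discRow'` (`…LiftLadderDiscRowTower`, letters `ρκ ρt : ℕ → PBond (F.P J) 0 → ℝ` with hypotheses `hκrel`, `hρ`).  ARCHITECT RULING
«ρκ-CURL» (px17 g22, 2026-08-31T21:44Z; group road 21:48:59Z): `ρκ` is priced by the FINE RELATIVE PLAQUETTES of the stage pair over the block pair.  THE GROUP ROAD IS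
ALREADY ON THE TREE (located by this seat at filing time, 22:05Z): px21 g23's (D♮)∕F4-rel «corr-rel» files ✓`…S2BetaRelativeSwapDefect` (A1), ✓`…S2BetaRelativeWordStokes`
(A2: ★★`dist1_loopHol_rel_le_local_SU` — the relative (0.4) member loops `dist1 (W_{c,i}(U₀)⁻¹·W_{c,i}(U)) ≤ K·[ε + 2θ·((ℓ+2)·η)]` from the THREE-BLOCK letters) and
✓`…S2BetaCorrLetterL2Relative` (B: ★`dist1_corr_rel_le_mean` — the relative correction factor by the mean relative member loop on the guard, via px8 g21
✓`…ExpMeanLogLipschitz`).  THIS FILE docks them to `discRow'`: for the stage pair `W := g_s • Ū^s(e^ζU₀)`, `W₁ := g₀_s • Ū^s U₁` at the child height `s = K − (J+t+1)`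
and the parent bond `c_b = ⟨blockOf b₋, dir b⟩` of every face-crossing `READ′_t(B)` bond `b = σ₂ ℓ′`, the `hκrel` binder of `discRow'` holds VERBATIM with
**`ρκ t B := 3·(K·(ρP t B + 2·a′ t·((ℓ + 2)·δC t B)))`**, `K = ℓ²∕4`, `ℓ = ((F.P K).d + 2)·(F.P K).L = 5L`, from THREE letters per `(t, B)` in the tower's own currency:
`ρP t B ≥ dist1 ((P_{W₁} q)⁻¹·P_W q)` over the three blocks `{blockOf b₋ − e_dir, blockOf b₋, blockOf b₋ + e_dir}` of every such `b` (c₁'s CELL-MASS object read in the stage gauge: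
`(P_{g•ŪU₀} q)⁻¹·P_{g•Ū(e^ζU₀)} q` is conjugate to the TEXT's `(P_{ŪU₀} q)⁻¹·P_{Ū(e^ζU₀)} q`; read thickness `≥ 2L+1`, REGION FLAG (i)), `δC t B ≥ dist1 (W₁(e)⁻¹·W(e))` there
(E′∕READ′ class via the 2-block cover, REGION FLAG (ii)), and the stage plaquette classes `PlaqSmall (a t) W₁`, `PlaqSmall (a′ t) W` (SIZE) with the NUMERIC guard
`K·(a t + a′ t) < δ_SU(2)` (loop guards by lit ✓`dist1_loopHol_le_local`; `1 + 4ρ ≤ 3`).  LINEAR in `ρP` and in `δC` (the latter with the θ-small factor `a′ t`): the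
`ρκ`-column of `discRow'`'s `X t` splits as in §2 — CELL-MASS column (px10 g26 ✓∕⧗`curlBudget_core`) + an `a′²`-small feedback column (RULING «β_X» (b)).
`--kind proof --supports stmt-QuantumFields-20520 --as helper`, count-neutral, DEFINITION-FREE (0 `def`, 0 `instance`, 0 `sorry`; default heartbeats).

WHAT IS PROVED (sorry-free).
* §1 ★★★`hκrel_of_regionLetters` — `discRow'`'s `hκrel` hypothesis for the explicit `ρκ` above, from `hρP`, `hδC`, `hplaq₁`, `hplaqW`, `hthrN`.
* §2 ★`sq_rhoKappa_le` — the algebraic split of `ρκ(t,B)²` into the CELL-MASS column and the feedback column.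
* §3 `stage_eq_gaugeAct_iter` and ★★★`hκrel_of_textLetters` (gauge identities ✓`…RelativeGaugeCovariance.dist1_relPlaq_gaugeAct`∕`dist1_gaugeAct_chord`) — the same discharge from the letters in the UNGAUGED TEXT
  currency of the c₁ core ∕ `E′`: `dist1 ((P_{Ū^sU₀} q)⁻¹·P_{Ū^s(e^ζU₀)} q) ≤ ρP t B`, `dist1 ((Ū^sU₀ e)⁻¹·Ū^s(e^ζU₀) e) ≤ δC t B`, `PlaqSmall (a t) (Ū^sU₀)` ((BKG)'s object, px20's `hplaq`
  VERBATIM), `PlaqSmall (a′ t) (Ū^s(e^ζU₀))`, under `discRow'`'s gauge binders `hT3`, `hT3'`, `hU₀` (the stage pair is a COMMON gauge transform of the ungauged pair, ✓`iter_eq_of_bottom`).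

HONEST.  Plumbing of the tree's relative Stokes ∕ eml-Lipschitz letters at the tower (bond by bond) + one `nlinarith`; nothing of Bałaban's renormalisation-group analysis is
asserted or proved; `ρP`, `δC`, `a`, `a′` and their budgets∕covers, the stage gauges, (BKG), every ladder letter, (ST)∕LOC, `h3` are HYPOTHESES or other seats'; GAP♯∘
(`stub_uniformFibreGapOrbit`, registry 3732b7df UNTOUCHED, 0∕5), the five REGISTERED stubs, S2β, crux 20520, 19936, 19200, `YM3TorusSU2` are NOT proved; no summit
statement is proved by a helper; rung R3 = SU(2) YM₃ on T³ at fixed lattice data — NOT d = 4, NOT infinite volume, NOT a mass gap, NOT Clay; the Yang–Mills mass gap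
is NOT proved.  Axioms standard.

References: T. Bałaban, CMP **98** (1985) 17–51 [Balaban1985Averaging] ((19)–(21) pp.21–22, Prop. 1 (51) p.26, Prop. 4 (128)–(135) pp.37–38); CMP **109** (1987)
249–301 [Balaban1987RG1] ((0.3)–(0.8) pp.252–253); CMP **99** (1985) 75–102 [Balaban1985RegularSpaces] ((1.29) p.81).
-/

set_option autoImplicit false

namespace Summit.QuantumFields.YangMills.Theorems.FluctuationComparisonRegPrIntLS2BetaKappaRatioTower

open Literature.MathematicalPhysics.QuantumLattice (su2Quat)
open Literature.MathematicalPhysics.QuantumFieldTheory.Balaban1983to89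
open T4Continuum T3ContinuumYM3Torus T3TiltDescent T3LevelShift BlockAveraging AveragingRT B10Eq47AxialChi
open B10Eq27TorusAxialLog (rel)
open T4CubeChartGnomonic (SU2)
open T4HaarSU2ExpChart (expPoint)
open ExpMeanLog (deltaSU)
open T3UnitLawDensityEML (ℰp)
open T4TiltOscillation (bdev)
open BlockAveragingPlaquetteBoundLocal (dist1_loopHol_le_local)
open Summit.QuantumFields.YangMills.Theorems.FluctuationComparisonRegPrIntLS2BetaRelativeStokes (dist1_mul_inv_eq_rel)
open Summit.QuantumFields.YangMills.Theorems.FluctuationComparisonRegPrIntLS2BetaRelativeWordStokes (dist1_loopHol_rel_le_local_SU)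
open Summit.QuantumFields.YangMills.Theorems.FluctuationComparisonRegPrIntLS2BetaCorrLetterL2Relative (dist1_corr_rel_le_mean)
open Summit.QuantumFields.YangMills.Theorems.FluctuationComparisonRegPrIntLS2BetaLiftLadderCombRow (iter_eq_of_bottom)
open Summit.QuantumFields.YangMills.Theorems.FluctuationComparisonRegPrIntLS2BetaRelativeGaugeCovariance (dist1_gaugeAct_chord dist1_relPlaq_gaugeAct)

variable {F : T3Family}

/-! ## §1 `hκrel` from the region letters -/

/-- ★★★ **`discRow'`'s `hκrel` FROM REGION LETTERS IN THE STAGE PAIR's OWN CURRENCY.**  Stage pair at the child height `s = K − (J+t+1)`: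
`W_t := g_s • Ū^s(e^ζU₀)`, `W₁,t := g₀_s • Ū^s U₁`.  Letters per `(t, B)`: `hρP` (relative plaquettes `dist1 ((P_{W₁} q)⁻¹·P_W q)` of the pair over the three blocks
`{blockOf b₋ − e_dir, blockOf b₋, blockOf b₋ + e_dir}` of every `READ′_t(B)` bond `b = σ₂ ℓ′`: `≤ ρP t B`), `hδC` (relative bond variables `dist1 (W₁(e)⁻¹·W(e))` there: `≤ δC t B`),
the stage plaquette classes `hplaq₁ : PlaqSmall (a t) W₁,t`, `hplaqW : PlaqSmall (a′ t) W_t`, and the numeric guard `K·(a t + a′ t) < δ_SU(2)`, `K = ℓ²∕4`.  Conclusion: the `hκrel`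
binder of `discRow'` VERBATIM with `ρκ t B := 3·(K·(ρP t B + 2·a′ t·((ℓ + 2)·δC t B)))`, `ℓ = ((F.P K).d + 2)·(F.P K).L` (tree ✓`dist1_corr_rel_le_mean` ∘ ✓`dist1_loopHol_rel_le_local_SU`
at `c := ⟨blockOf b₋, dir b⟩`, loop guards by lit ✓`dist1_loopHol_le_local`, `1 + 4ρ ≤ 3`).
[cite: Balaban1987RG1, (0.3)-(0.8) pp.252-253; Balaban1985Averaging, (19)-(21) pp.21-22, Prop. 1 (51) p.26; Balaban1985RegularSpaces, (1.29) p.81] -/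
theorem hκrel_of_regionLetters
    {J K : ℕ} (U₀ : GaugeField (F.P K) 0 (Matrix.specialUnitaryGroup (Fin 2) ℂ)) (ζ : PBond (F.P K) 0 → EuclideanSpace ℝ (Fin 3))
    (U₁ : GaugeField (F.P K) 0 SU2) (g g₀ : (j : ℕ) → Site (F.P K) j → SU2)
    (ρP δC : ℕ → PBond (F.P J) 0 → ℝ) (a a' : ℕ → ℝ)
    (hρP0 : ∀ t B, 0 ≤ ρP t B) (hδC0 : ∀ t B, 0 ≤ δC t B) (ha0 : ∀ t, 0 ≤ a t) (ha0' : ∀ t, 0 ≤ a' t)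
    (hplaq₁ : ∀ t, t < K - J → PlaqSmall (a t)
      (GaugeField.gaugeAct (g₀ (K - (J + (t + 1)))) (Averaging.iter (fun k => blockAvg (P := F.P K) (j := k) ℰp) (K - (J + (t + 1))) U₁)))
    (hplaqW : ∀ t, t < K - J → PlaqSmall (a' t)
      (GaugeField.gaugeAct (g (K - (J + (t + 1)))) (Averaging.iter (fun k => blockAvg (P := F.P K) (j := k) ℰp) (K - (J + (t + 1))) (fun ℓ => expPoint (ζ ℓ) * U₀ ℓ))))
    (hthrN : ∀ t, t < K - J → (((((F.P K).d + 2) * (F.P K).L : ℕ) : ℝ) ^ 2 / 4) * (a t + a' t) < deltaSU (Fin 2))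
    (hρP : ∀ (t : ℕ) (ht : t < K - J) (B : PBond (F.P J) 0) (q : Plaq (F.P K) (K - (J + (t + 1)))),
      (∃ ℓ' : PBond (F.P (J + (t + 1))) 0, (∃ z : Site (F.P (J + (t + 1))) 0,
                (B14.Eq22Determines.blockIter (t + 1) z = (bondShift (F.sitesPerDir_eq (m := F.m) (K := J) (j := 0) (m' := F.m) (K' := J + (t + 1)) (j' := t + 1) (by omega)) B).src ∨ B14.Eq22Determines.blockIter (t + 1) z = (bondShift (F.sitesPerDir_eq (m := F.m) (K := J) (j := 0) (m' := F.m) (K' := J + (t + 1)) (j' := t + 1) (by omega)) B).tgt) ∧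
                ∀ ν, (B10Eq27TorusAxialLog.rel z ℓ'.src ν).natAbs ≤ 2) ∧
        (blockOf q.src = (blockOf (bondShift (F.sitesPerDir_eq (m := F.m) (K := J + (t + 1)) (j := 0) (m' := F.m) (K' := K) (j' := (K - (J + (t + 1)))) (by omega)) ℓ').src).unshift (bondShift (F.sitesPerDir_eq (m := F.m) (K := J + (t + 1)) (j := 0) (m' := F.m) (K' := K) (j' := (K - (J + (t + 1)))) (by omega)) ℓ').dir ∨
          blockOf q.src = blockOf (bondShift (F.sitesPerDir_eq (m := F.m) (K := J + (t + 1)) (j := 0) (m' := F.m) (K' := K) (j' := (K - (J + (t + 1)))) (by omega)) ℓ').src ∨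
          blockOf q.src = (blockOf (bondShift (F.sitesPerDir_eq (m := F.m) (K := J + (t + 1)) (j := 0) (m' := F.m) (K' := K) (j' := (K - (J + (t + 1)))) (by omega)) ℓ').src).shift (bondShift (F.sitesPerDir_eq (m := F.m) (K := J + (t + 1)) (j := 0) (m' := F.m) (K' := K) (j' := (K - (J + (t + 1)))) (by omega)) ℓ').dir)) →
      dist1 ((GaugeField.plaqHol (GaugeField.gaugeAct (g₀ (K - (J + (t + 1)))) (Averaging.iter (fun k => blockAvg (P := F.P K) (j := k) ℰp) (K - (J + (t + 1))) U₁)) q)⁻¹ *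
        GaugeField.plaqHol (GaugeField.gaugeAct (g (K - (J + (t + 1)))) (Averaging.iter (fun k => blockAvg (P := F.P K) (j := k) ℰp) (K - (J + (t + 1))) (fun ℓ => expPoint (ζ ℓ) * U₀ ℓ))) q) ≤ ρP t B)
    (hδC : ∀ (t : ℕ) (ht : t < K - J) (B : PBond (F.P J) 0) (e : PBond (F.P K) (K - (J + (t + 1)))),
      (∃ ℓ' : PBond (F.P (J + (t + 1))) 0, (∃ z : Site (F.P (J + (t + 1))) 0,
                (B14.Eq22Determines.blockIter (t + 1) z = (bondShift (F.sitesPerDir_eq (m := F.m) (K := J) (j := 0) (m' := F.m) (K' := J + (t + 1)) (j' := t + 1) (by omega)) B).src ∨ B14.Eq22Determines.blockIter (t + 1) z = (bondShift (F.sitesPerDir_eq (m := F.m) (K := J) (j := 0) (m' := F.m) (K' := J + (t + 1)) (j' := t + 1) (by omega)) B).tgt) ∧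
                ∀ ν, (B10Eq27TorusAxialLog.rel z ℓ'.src ν).natAbs ≤ 2) ∧
        (blockOf e.src = (blockOf (bondShift (F.sitesPerDir_eq (m := F.m) (K := J + (t + 1)) (j := 0) (m' := F.m) (K' := K) (j' := (K - (J + (t + 1)))) (by omega)) ℓ').src).unshift (bondShift (F.sitesPerDir_eq (m := F.m) (K := J + (t + 1)) (j := 0) (m' := F.m) (K' := K) (j' := (K - (J + (t + 1)))) (by omega)) ℓ').dir ∨
          blockOf e.src = blockOf (bondShift (F.sitesPerDir_eq (m := F.m) (K := J + (t + 1)) (j := 0) (m' := F.m) (K' := K) (j' := (K - (J + (t + 1)))) (by omega)) ℓ').src ∨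
          blockOf e.src = (blockOf (bondShift (F.sitesPerDir_eq (m := F.m) (K := J + (t + 1)) (j := 0) (m' := F.m) (K' := K) (j' := (K - (J + (t + 1)))) (by omega)) ℓ').src).shift (bondShift (F.sitesPerDir_eq (m := F.m) (K := J + (t + 1)) (j := 0) (m' := F.m) (K' := K) (j' := (K - (J + (t + 1)))) (by omega)) ℓ').dir)) →
      dist1 ((GaugeField.gaugeAct (g₀ (K - (J + (t + 1)))) (Averaging.iter (fun k => blockAvg (P := F.P K) (j := k) ℰp) (K - (J + (t + 1))) U₁) e)⁻¹ *
        GaugeField.gaugeAct (g (K - (J + (t + 1)))) (Averaging.iter (fun k => blockAvg (P := F.P K) (j := k) ℰp) (K - (J + (t + 1))) (fun ℓ => expPoint (ζ ℓ) * U₀ ℓ)) e) ≤ δC t B) :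
    ∀ (t : ℕ) (ht : t < K - J) (B : PBond (F.P J) 0) (ℓ' : PBond (F.P (J + (t + 1))) 0), (∃ z : Site (F.P (J + (t + 1))) 0,
                (B14.Eq22Determines.blockIter (t + 1) z = (bondShift (F.sitesPerDir_eq (m := F.m) (K := J) (j := 0) (m' := F.m) (K' := J + (t + 1)) (j' := t + 1) (by omega)) B).src ∨ B14.Eq22Determines.blockIter (t + 1) z = (bondShift (F.sitesPerDir_eq (m := F.m) (K := J) (j := 0) (m' := F.m) (K' := J + (t + 1)) (j' := t + 1) (by omega)) B).tgt) ∧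
                ∀ ν, (B10Eq27TorusAxialLog.rel z ℓ'.src ν).natAbs ≤ 2) →
      blockOf ((bondShift (F.sitesPerDir_eq (m := F.m) (K := J + (t + 1)) (j := 0) (m' := F.m) (K' := K) (j' := (K - (J + (t + 1)))) (by omega)) ℓ').src.shift (bondShift (F.sitesPerDir_eq (m := F.m) (K := J + (t + 1)) (j := 0) (m' := F.m) (K' := K) (j' := (K - (J + (t + 1)))) (by omega)) ℓ').dir) ≠ blockOf (bondShift (F.sitesPerDir_eq (m := F.m) (K := J + (t + 1)) (j := 0) (m' := F.m) (K' := K) (j' := (K - (J + (t + 1)))) (by omega)) ℓ').src →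
      dist1 (corr ℰp (GaugeField.gaugeAct (g (K - (J + (t + 1)))) (Averaging.iter (fun k => blockAvg (P := F.P K) (j := k) ℰp) (K - (J + (t + 1))) (fun ℓ => expPoint (ζ ℓ) * U₀ ℓ))) ⟨blockOf (bondShift (F.sitesPerDir_eq (m := F.m) (K := J + (t + 1)) (j := 0) (m' := F.m) (K' := K) (j' := (K - (J + (t + 1)))) (by omega)) ℓ').src, (bondShift (F.sitesPerDir_eq (m := F.m) (K := J + (t + 1)) (j := 0) (m' := F.m) (K' := K) (j' := (K - (J + (t + 1)))) (by omega)) ℓ').dir⟩ *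
        (corr ℰp (GaugeField.gaugeAct (g₀ (K - (J + (t + 1)))) (Averaging.iter (fun k => blockAvg (P := F.P K) (j := k) ℰp) (K - (J + (t + 1))) U₁)) ⟨blockOf (bondShift (F.sitesPerDir_eq (m := F.m) (K := J + (t + 1)) (j := 0) (m' := F.m) (K' := K) (j' := (K - (J + (t + 1)))) (by omega)) ℓ').src, (bondShift (F.sitesPerDir_eq (m := F.m) (K := J + (t + 1)) (j := 0) (m' := F.m) (K' := K) (j' := (K - (J + (t + 1)))) (by omega)) ℓ').dir⟩)⁻¹) ≤
        (fun (t : ℕ) (B : PBond (F.P J) 0) => 3 * ((((((F.P K).d + 2) * (F.P K).L : ℕ) : ℝ) ^ 2 / 4) *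
          (ρP t B + 2 * a' t * ((((((F.P K).d + 2) * (F.P K).L : ℕ) : ℝ) + 2) * δC t B)))) t B := by
  intro t ht B ℓ' hread _hface
  beta_reduce
  -- the child height and the two stage fields
  have hsK : (K - (J + (t + 1))) + 1 ≤ (F.P K).m + (F.P K).K := by show (K - (J + (t + 1))) + 1 ≤ F.m + K; omega
  set s := K - (J + (t + 1)) with hs
  set W : GaugeField (F.P K) s SU2 :=
    GaugeField.gaugeAct (g s) (Averaging.iter (fun k => blockAvg (P := F.P K) (j := k) ℰp) s (fun ℓ => expPoint (ζ ℓ) * U₀ ℓ)) with hW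
  set W₁ : GaugeField (F.P K) s SU2 :=
    GaugeField.gaugeAct (g₀ s) (Averaging.iter (fun k => blockAvg (P := F.P K) (j := k) ℰp) s U₁) with hW₁
  set b : PBond (F.P K) s := bondShift (F.sitesPerDir_eq (m := F.m) (K := J + (t + 1)) (j := 0) (m' := F.m) (K' := K) (j' := s) (by omega)) ℓ' with hb
  set c : PBond (F.P K) (s + 1) := ⟨blockOf b.src, b.dir⟩ with hc
  have hcs : c.src = blockOf b.src := rfl
  have hct : c.tgt = (blockOf b.src).shift b.dir := rfl
  have hcd : c.dir = b.dir := rfl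
  -- numeric letters
  set ℓ : ℝ := ((((F.P K).d + 2) * (F.P K).L : ℕ) : ℝ) with hℓ
  set ρg : ℝ := ℓ ^ 2 / 4 * (a t + a' t) with hρg
  have hρgN : ρg < deltaSU (Fin 2) := hthrN t ht
  -- loop guards of both stage fields at `c`, from the plaquette classes (lit local Stokes)
  have hW : ∀ i, dist1 (loopHol W c i) ≤ ρg := fun i =>
    (dist1_loopHol_le_local (ha0' t) hsK c (fun q _ => hplaqW t ht q) i).trans
      (by have := ha0 t; have := ha0' t; rw [hρg]; nlinarith)
  have hW₁ : ∀ i, dist1 (loopHol W₁ c i) ≤ ρg := fun i =>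
    (dist1_loopHol_le_local (ha0 t) hsK c (fun q _ => hplaq₁ t ht q) i).trans
      (by have := ha0 t; have := ha0' t; rw [hρg]; nlinarith)
  -- the three region letters at `c`
  have hε : ∀ q : Plaq (F.P K) s, (blockOf q.src = c.src.unshift c.dir ∨ blockOf q.src = c.src ∨ blockOf q.src = c.tgt) →
      dist1 ((GaugeField.plaqHol W₁ q)⁻¹ * GaugeField.plaqHol W q) ≤ ρP t B := fun q hq =>
    hρP t ht B q ⟨ℓ', hread, by rw [hcs, hct, hcd] at hq; exact hq⟩
  have hθ : ∀ q : Plaq (F.P K) s, (blockOf q.src = c.src.unshift c.dir ∨ blockOf q.src = c.src ∨ blockOf q.src = c.tgt) →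
      dist1 (GaugeField.plaqHol W q) < a' t := fun q _ => hplaqW t ht q
  have hη : ∀ e : PBond (F.P K) s, (blockOf e.src = c.src.unshift c.dir ∨ blockOf e.src = c.src ∨ blockOf e.src = c.tgt) →
      dist1 (bdev W W₁ e) ≤ δC t B := fun e he =>
    hδC t ht B e ⟨ℓ', hread, by rw [hcs, hct, hcd] at he; exact he⟩
  -- the relative member loops (tree A2) and the relative correction factor by their mean (tree B)
  have hmem : ∀ i, dist1 ((loopHol W₁ c i)⁻¹ * loopHol W c i) ≤ ℓ ^ 2 / 4 * (ρP t B + 2 * a' t * ((ℓ + 2) * δC t B)) := fun i =>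
    dist1_loopHol_rel_le_local_SU W W₁ (ha0' t) (hρP0 t B) (hδC0 t B) hsK c hθ hε hη i
  have h0 := dist1_corr_rel_le_mean W W₁ c hρgN hW hW₁
  have hB0 : 0 ≤ ℓ ^ 2 / 4 * (ρP t B + 2 * a' t * ((ℓ + 2) * δC t B)) := by
    have := ha0' t; have := hρP0 t B; have := hδC0 t B; positivity
  have hcard : (0 : ℝ) < (Fintype.card (Idx (F.P K)) : ℝ) := by exact_mod_cast Fintype.card_pos
  have hmean : ((Fintype.card (Idx (F.P K)) : ℝ))⁻¹ * ∑ i, dist1 ((loopHol W₁ c i)⁻¹ * loopHol W c i) ≤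
      ℓ ^ 2 / 4 * (ρP t B + 2 * a' t * ((ℓ + 2) * δC t B)) := by
    rw [inv_mul_le_iff₀ hcard]
    calc ∑ i, dist1 ((loopHol W₁ c i)⁻¹ * loopHol W c i) ≤ ∑ _i : Idx (F.P K), ℓ ^ 2 / 4 * (ρP t B + 2 * a' t * ((ℓ + 2) * δC t B)) :=
          Finset.sum_le_sum fun i _ => hmem i
      _ = (Fintype.card (Idx (F.P K)) : ℝ) * (ℓ ^ 2 / 4 * (ρP t B + 2 * a' t * ((ℓ + 2) * δC t B))) := by
          rw [Finset.sum_const, Finset.card_univ, nsmul_eq_mul]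
  have hρg0 : 0 ≤ ρg := by have := ha0 t; have := ha0' t; positivity
  have hρg3 : 1 + 4 * ρg ≤ 3 := by have := ExpMeanLog.lt_third_of_lt_deltaSU hρgN; linarith
  rw [dist1_mul_inv_eq_rel]
  calc dist1 ((corr ℰp W₁ c)⁻¹ * corr ℰp W c)
      ≤ (1 + 4 * ρg) * (((Fintype.card (Idx (F.P K)) : ℝ))⁻¹ * ∑ i, dist1 ((loopHol W₁ c i)⁻¹ * loopHol W c i)) := h0
    _ ≤ 3 * (ℓ ^ 2 / 4 * (ρP t B + 2 * a' t * ((ℓ + 2) * δC t B))) :=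
        mul_le_mul hρg3 hmean (mul_nonneg (inv_nonneg.mpr hcard.le) (Finset.sum_nonneg fun _ _ => GaugeGroup.dist1_nonneg _)) (by norm_num)

/-! ## §2 The algebraic split of `ρκ²` into the CELL-MASS column and the feedback column -/

/-- ★ **THE SPLIT OF THE `ρκ`-COLUMN**: for real `ρP, δC, a′, K, ℓ`,
`(3·(K·(ρP + 2·a′·((ℓ + 2)·δC))))² ≤ 2·(3K)²·ρP² + 2·(3K·(2·(ℓ + 2)·a′))²·δC²` — the first summand is the c₁ CELL-MASS column, the second the feedback column
(θ-small factor `a′²`). [folklore] -/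
theorem sq_rhoKappa_le (ρP δC a' K ℓ : ℝ) :
    (3 * (K * (ρP + 2 * a' * ((ℓ + 2) * δC)))) ^ 2 ≤
      2 * (3 * K) ^ 2 * ρP ^ 2 + 2 * (3 * K * (2 * (ℓ + 2) * a')) ^ 2 * δC ^ 2 := by
  have e : 3 * (K * (ρP + 2 * a' * ((ℓ + 2) * δC))) = (3 * K) * ρP + (3 * K * (2 * (ℓ + 2) * a')) * δC := by ring
  rw [e]
  nlinarith [sq_nonneg ((3 * K) * ρP - (3 * K * (2 * (ℓ + 2) * a')) * δC)]


/-! ## §3 The same discharge from letters in the ungauged TEXT currency -/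

section Text

variable {P : Params} {j : ℕ} {G : Type*} [GaugeGroup G]

/-- THE SECOND STAGE FIELD IS THE FIRST GAUGE APPLIED TO THE BACKGROUND TOWER: under (T3)×2 and `U₀ = (g₀⁻¹g₀₀)•U₁`, `g₀_j • Ū^j U₁ = g_j • Ū^j U₀`
(✓`iter_eq_of_bottom` regauged). [cite: Balaban1985Averaging, (8) and (11) p.19] -/
theorem stage_eq_gaugeAct_iter (av : ∀ i, Averaging P i G) (g g₀ : (i : ℕ) → Site P i → G) (U₁ U₀ : GaugeField P 0 G)
    (hT3 : ∀ X : GaugeField P 0 G, Averaging.iter av j (GaugeField.gaugeAct (g 0) X) = GaugeField.gaugeAct (g j) (Averaging.iter av j X))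
    (hT3' : ∀ X : GaugeField P 0 G, Averaging.iter av j (GaugeField.gaugeAct (g₀ 0) X) = GaugeField.gaugeAct (g₀ j) (Averaging.iter av j X))
    (hU₀ : U₀ = GaugeField.gaugeAct (fun x => (g 0 x)⁻¹ * g₀ 0 x) U₁) :
    GaugeField.gaugeAct (g₀ j) (Averaging.iter av j U₁) = GaugeField.gaugeAct (g j) (Averaging.iter av j U₀) := by
  rw [iter_eq_of_bottom av g g₀ U₁ U₀ hT3 hT3' hU₀]
  funext b
  simp only [GaugeField.gaugeAct]
  group

end Text

/-- ★★★ **`discRow'`'s `hκrel` FROM LETTERS IN THE UNGAUGED TEXT CURRENCY** (the c₁ core's ∕ `E′`'s objects): under `discRow'`'s gauge binders `hT3`, `hT3'`,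
`hU₀`, the letters `hρT : dist1 ((P_{Ū^sU₀} q)⁻¹·P_{Ū^s(e^ζU₀)} q) ≤ ρP t B` and `hδT : dist1 ((Ū^sU₀ e)⁻¹·Ū^s(e^ζU₀) e) ≤ δC t B` over the three blocks of every
`READ′_t(B)` bond, the plaquette classes `hplaq : PlaqSmall (a t) (Ū^sU₀)` ((BKG)'s object, `discRow'`'s binder VERBATIM) and `hplaqP : PlaqSmall (a′ t) (Ū^s(e^ζU₀))`,
and the numeric guard `K·(a t + a′ t) < δ_SU(2)` give the `hκrel` binder with the same `ρκ t B := 3·(K·(ρP t B + 2·a′ t·((ℓ + 2)·δC t B)))` (§1 after §3's three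
gauge identities). [cite: Balaban1987RG1, (0.3)-(0.8) pp.252-253; Balaban1985Averaging, (8)-(11) p.19, (19)-(21) pp.21-22; Balaban1985RegularSpaces, (1.29) p.81] -/
theorem hκrel_of_textLetters
    {J K : ℕ} (U₀ : GaugeField (F.P K) 0 (Matrix.specialUnitaryGroup (Fin 2) ℂ)) (ζ : PBond (F.P K) 0 → EuclideanSpace ℝ (Fin 3))
    (U₁ : GaugeField (F.P K) 0 SU2) (g g₀ : (j : ℕ) → Site (F.P K) j → SU2)
    (hT3 : ∀ X : GaugeField (F.P K) 0 SU2, ∀ j, j ≤ K - J →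
      Averaging.iter (fun k => blockAvg (P := F.P K) (j := k) ℰp) j (GaugeField.gaugeAct (g 0) X) =
        GaugeField.gaugeAct (g j) (Averaging.iter (fun k => blockAvg (P := F.P K) (j := k) ℰp) j X))
    (hT3' : ∀ X : GaugeField (F.P K) 0 SU2, ∀ j, j ≤ K - J →
      Averaging.iter (fun k => blockAvg (P := F.P K) (j := k) ℰp) j (GaugeField.gaugeAct (g₀ 0) X) =
        GaugeField.gaugeAct (g₀ j) (Averaging.iter (fun k => blockAvg (P := F.P K) (j := k) ℰp) j X))
    (hU₀ : U₀ = GaugeField.gaugeAct (fun x => (g 0 x)⁻¹ * g₀ 0 x) U₁)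
    (ρP δC : ℕ → PBond (F.P J) 0 → ℝ) (a a' : ℕ → ℝ)
    (hρP0 : ∀ t B, 0 ≤ ρP t B) (hδC0 : ∀ t B, 0 ≤ δC t B) (ha0 : ∀ t, 0 ≤ a t) (ha0' : ∀ t, 0 ≤ a' t)
    (hplaq : ∀ t, t < K - J → PlaqSmall (a t) (Averaging.iter (fun k => blockAvg (P := F.P K) (j := k) ℰp) (K - (J + (t + 1))) U₀))
    (hplaqP : ∀ t, t < K - J → PlaqSmall (a' t)
      (Averaging.iter (fun k => blockAvg (P := F.P K) (j := k) ℰp) (K - (J + (t + 1))) (fun ℓ => expPoint (ζ ℓ) * U₀ ℓ)))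
    (hthrN : ∀ t, t < K - J → (((((F.P K).d + 2) * (F.P K).L : ℕ) : ℝ) ^ 2 / 4) * (a t + a' t) < deltaSU (Fin 2))
    (hρT : ∀ (t : ℕ) (ht : t < K - J) (B : PBond (F.P J) 0) (q : Plaq (F.P K) (K - (J + (t + 1)))),
      (∃ ℓ' : PBond (F.P (J + (t + 1))) 0, (∃ z : Site (F.P (J + (t + 1))) 0,
                (B14.Eq22Determines.blockIter (t + 1) z = (bondShift (F.sitesPerDir_eq (m := F.m) (K := J) (j := 0) (m' := F.m) (K' := J + (t + 1)) (j' := t + 1) (by omega)) B).src ∨ B14.Eq22Determines.blockIter (t + 1) z = (bondShift (F.sitesPerDir_eq (m := F.m) (K := J) (j := 0) (m' := F.m) (K' := J + (t + 1)) (j' := t + 1) (by omega)) B).tgt) ∧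
                ∀ ν, (B10Eq27TorusAxialLog.rel z ℓ'.src ν).natAbs ≤ 2) ∧
        (blockOf q.src = (blockOf (bondShift (F.sitesPerDir_eq (m := F.m) (K := J + (t + 1)) (j := 0) (m' := F.m) (K' := K) (j' := (K - (J + (t + 1)))) (by omega)) ℓ').src).unshift (bondShift (F.sitesPerDir_eq (m := F.m) (K := J + (t + 1)) (j := 0) (m' := F.m) (K' := K) (j' := (K - (J + (t + 1)))) (by omega)) ℓ').dir ∨
          blockOf q.src = blockOf (bondShift (F.sitesPerDir_eq (m := F.m) (K := J + (t + 1)) (j := 0) (m' := F.m) (K' := K) (j' := (K - (J + (t + 1)))) (by omega)) ℓ').src ∨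
          blockOf q.src = (blockOf (bondShift (F.sitesPerDir_eq (m := F.m) (K := J + (t + 1)) (j := 0) (m' := F.m) (K' := K) (j' := (K - (J + (t + 1)))) (by omega)) ℓ').src).shift (bondShift (F.sitesPerDir_eq (m := F.m) (K := J + (t + 1)) (j := 0) (m' := F.m) (K' := K) (j' := (K - (J + (t + 1)))) (by omega)) ℓ').dir)) →
      dist1 ((GaugeField.plaqHol (Averaging.iter (fun k => blockAvg (P := F.P K) (j := k) ℰp) (K - (J + (t + 1))) U₀) q)⁻¹ *
        GaugeField.plaqHol (Averaging.iter (fun k => blockAvg (P := F.P K) (j := k) ℰp) (K - (J + (t + 1))) (fun ℓ => expPoint (ζ ℓ) * U₀ ℓ)) q) ≤ ρP t B)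
    (hδT : ∀ (t : ℕ) (ht : t < K - J) (B : PBond (F.P J) 0) (e : PBond (F.P K) (K - (J + (t + 1)))),
      (∃ ℓ' : PBond (F.P (J + (t + 1))) 0, (∃ z : Site (F.P (J + (t + 1))) 0,
                (B14.Eq22Determines.blockIter (t + 1) z = (bondShift (F.sitesPerDir_eq (m := F.m) (K := J) (j := 0) (m' := F.m) (K' := J + (t + 1)) (j' := t + 1) (by omega)) B).src ∨ B14.Eq22Determines.blockIter (t + 1) z = (bondShift (F.sitesPerDir_eq (m := F.m) (K := J) (j := 0) (m' := F.m) (K' := J + (t + 1)) (j' := t + 1) (by omega)) B).tgt) ∧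
                ∀ ν, (B10Eq27TorusAxialLog.rel z ℓ'.src ν).natAbs ≤ 2) ∧
        (blockOf e.src = (blockOf (bondShift (F.sitesPerDir_eq (m := F.m) (K := J + (t + 1)) (j := 0) (m' := F.m) (K' := K) (j' := (K - (J + (t + 1)))) (by omega)) ℓ').src).unshift (bondShift (F.sitesPerDir_eq (m := F.m) (K := J + (t + 1)) (j := 0) (m' := F.m) (K' := K) (j' := (K - (J + (t + 1)))) (by omega)) ℓ').dir ∨
          blockOf e.src = blockOf (bondShift (F.sitesPerDir_eq (m := F.m) (K := J + (t + 1)) (j := 0) (m' := F.m) (K' := K) (j' := (K - (J + (t + 1)))) (by omega)) ℓ').src ∨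
          blockOf e.src = (blockOf (bondShift (F.sitesPerDir_eq (m := F.m) (K := J + (t + 1)) (j := 0) (m' := F.m) (K' := K) (j' := (K - (J + (t + 1)))) (by omega)) ℓ').src).shift (bondShift (F.sitesPerDir_eq (m := F.m) (K := J + (t + 1)) (j := 0) (m' := F.m) (K' := K) (j' := (K - (J + (t + 1)))) (by omega)) ℓ').dir)) →
      dist1 ((Averaging.iter (fun k => blockAvg (P := F.P K) (j := k) ℰp) (K - (J + (t + 1))) U₀ e)⁻¹ *
        Averaging.iter (fun k => blockAvg (P := F.P K) (j := k) ℰp) (K - (J + (t + 1))) (fun ℓ => expPoint (ζ ℓ) * U₀ ℓ) e) ≤ δC t B) :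
    ∀ (t : ℕ) (ht : t < K - J) (B : PBond (F.P J) 0) (ℓ' : PBond (F.P (J + (t + 1))) 0), (∃ z : Site (F.P (J + (t + 1))) 0,
                (B14.Eq22Determines.blockIter (t + 1) z = (bondShift (F.sitesPerDir_eq (m := F.m) (K := J) (j := 0) (m' := F.m) (K' := J + (t + 1)) (j' := t + 1) (by omega)) B).src ∨ B14.Eq22Determines.blockIter (t + 1) z = (bondShift (F.sitesPerDir_eq (m := F.m) (K := J) (j := 0) (m' := F.m) (K' := J + (t + 1)) (j' := t + 1) (by omega)) B).tgt) ∧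
                ∀ ν, (B10Eq27TorusAxialLog.rel z ℓ'.src ν).natAbs ≤ 2) →
      blockOf ((bondShift (F.sitesPerDir_eq (m := F.m) (K := J + (t + 1)) (j := 0) (m' := F.m) (K' := K) (j' := (K - (J + (t + 1)))) (by omega)) ℓ').src.shift (bondShift (F.sitesPerDir_eq (m := F.m) (K := J + (t + 1)) (j := 0) (m' := F.m) (K' := K) (j' := (K - (J + (t + 1)))) (by omega)) ℓ').dir) ≠ blockOf (bondShift (F.sitesPerDir_eq (m := F.m) (K := J + (t + 1)) (j := 0) (m' := F.m) (K' := K) (j' := (K - (J + (t + 1)))) (by omega)) ℓ').src →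
      dist1 (corr ℰp (GaugeField.gaugeAct (g (K - (J + (t + 1)))) (Averaging.iter (fun k => blockAvg (P := F.P K) (j := k) ℰp) (K - (J + (t + 1))) (fun ℓ => expPoint (ζ ℓ) * U₀ ℓ))) ⟨blockOf (bondShift (F.sitesPerDir_eq (m := F.m) (K := J + (t + 1)) (j := 0) (m' := F.m) (K' := K) (j' := (K - (J + (t + 1)))) (by omega)) ℓ').src, (bondShift (F.sitesPerDir_eq (m := F.m) (K := J + (t + 1)) (j := 0) (m' := F.m) (K' := K) (j' := (K - (J + (t + 1)))) (by omega)) ℓ').dir⟩ *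
        (corr ℰp (GaugeField.gaugeAct (g₀ (K - (J + (t + 1)))) (Averaging.iter (fun k => blockAvg (P := F.P K) (j := k) ℰp) (K - (J + (t + 1))) U₁)) ⟨blockOf (bondShift (F.sitesPerDir_eq (m := F.m) (K := J + (t + 1)) (j := 0) (m' := F.m) (K' := K) (j' := (K - (J + (t + 1)))) (by omega)) ℓ').src, (bondShift (F.sitesPerDir_eq (m := F.m) (K := J + (t + 1)) (j := 0) (m' := F.m) (K' := K) (j' := (K - (J + (t + 1)))) (by omega)) ℓ').dir⟩)⁻¹) ≤
        (fun (t : ℕ) (B : PBond (F.P J) 0) => 3 * ((((((F.P K).d + 2) * (F.P K).L : ℕ) : ℝ) ^ 2 / 4) *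
          (ρP t B + 2 * a' t * ((((((F.P K).d + 2) * (F.P K).L : ℕ) : ℝ) + 2) * δC t B)))) t B := by
  -- the second stage field IS the first gauge applied to the background tower, at every height `s ≤ K − J`
  have hW₁ : ∀ t, t < K - J →
      GaugeField.gaugeAct (g₀ (K - (J + (t + 1)))) (Averaging.iter (fun k => blockAvg (P := F.P K) (j := k) ℰp) (K - (J + (t + 1))) U₁) =
        GaugeField.gaugeAct (g (K - (J + (t + 1)))) (Averaging.iter (fun k => blockAvg (P := F.P K) (j := k) ℰp) (K - (J + (t + 1))) U₀) := fun t ht =>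
    stage_eq_gaugeAct_iter (fun k => blockAvg (P := F.P K) (j := k) ℰp) g g₀ U₁ U₀ (fun X => hT3 X _ (by omega)) (fun X => hT3' X _ (by omega)) hU₀
  refine hκrel_of_regionLetters U₀ ζ U₁ g g₀ ρP δC a a' hρP0 hδC0 ha0 ha0' (fun t ht => ?_) (fun t ht => ?_) hthrN (fun t ht B q hq => ?_) (fun t ht B e he => ?_)
  · rw [hW₁ t ht]; exact (B12GaugeOrbits021.plaqSmall_gaugeAct_iff' _ _ _).2 (hplaq t ht)
  · exact (B12GaugeOrbits021.plaqSmall_gaugeAct_iff' _ _ _).2 (hplaqP t ht)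
  · rw [hW₁ t ht, dist1_relPlaq_gaugeAct]; exact hρT t ht B q hq
  · rw [hW₁ t ht, dist1_gaugeAct_chord]; exact hδT t ht B e he


end Summit.QuantumFields.YangMills.Theorems.FluctuationComparisonRegPrIntLS2BetaKappaRatioTower
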